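import Summits.CriticalPhenomena.PercolationContinuityZ3.Theorems.PercNearOneGluingNoHeavyLowerTailAPLLadderCells
import HarnessLib

/-!
# `NoHeavyLowerTail` (stmt-CriticalPhenomena-4575) — LADDER NETWORKS II: the balanced ladder and its four numbers in closed form

Support file (prover prim-ineq-gen-8 gen 61; `--supports stmt-CriticalPhenomena-4575`; memo
run/shared/lean/prim/prim-ineq-gen-8/FINDING-gen61-SPTHEOREM.md §2).  No definitions, no named facts, no sorries.

THE BALANCED LADDER (the extremal family of the series–parallel theorem `sp_E_le`).  Vertices `z 0, z 1, z 2, …` (pairwise distinct on the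
indices used); the CORE after `n` rounds is the edge set `L n` with
`L 0 = {s(z 0, z 1), s(z 0, z 2)}` (a path through the attachment vertex `g = z 0`, both edges of weight `2/3`) and
`L (r+1) = {s(z(2r+3), z(2r+1))} ∪ (L r ∪ {s(z(2r+1), z(2r+2))}) ∪ {s(z(2r+4), z(2r+2))}`
(round `r`: a RUNG of weight `w` between the current ports `z(2r+1), z(2r+2)`, then RAILS of weight `c = (3+w)/(3(1+w))` to the new ports
`z(2r+3), z(2r+4)`); so `L n` is a ladder (`2n+3` vertices, two-terminal series–parallel between its last two vertices).  The family `L` is a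
hypothesis (`hL0`, `hLs`), instantiated by recursion in `…APLLadderSharpness`.
* `vee_numbers` — the numbers `(p, π, τ, m) = (x, y, xy, 0)` of a two-edge path `u — g — v`;
* `ladder_edges`, `ladder_vertex`, `ladder_rung_fresh`, `ladder_new_fresh` — bookkeeping (which pairs are edges / vertices of `L n`);
* **`ladder_numbers`** — for `(g; u, v) = (z 0; z(2n+1), z(2n+2))` on `L n`:
  `P(u ∈ cl g) = P(v ∈ cl g) = (2/3)·λⁿ`, `P(u, v ∈ cl g) = (4/9)·λⁿ`, `P(u ∉ cl g, v ∈ cl u) = F^[n](4/9) − (4/9)·λⁿ`,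
  where `λ = c²(1+w)` and `F(s) = c²(s + w(1−s))` (so `s_n := P(u ↔ v) = F^[n](4/9)`): the shape `p/τ = π/τ = 3/2` is invariant exactly
  because `c(1 + w/3) = c²(1 + w)`, i.e. `c = (3+w)/(3(1+w))` (moves `rung`, `rail_u`, `rail_v` of `…APLLadderCells`).
Consequently `E_core := τ²/(pπ·s) = 4/(9 s_n) ↑ 4/(9 s*) = 28/27 − 16w²/(27(3+w)²)` (`s* = (3+w)²/(21+14w+w²)` the fixed point of `F`),
which is the content of the sharpness theorem of `…APLLadderSharpness`. [this work]
-/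

namespace Summit.CriticalPhenomena.PercolationContinuityZ3.Theorems

namespace APL

open Literature.Probability.Percolation Literature.Probability.Percolation.Gladkov Literature.Probability.Percolation.DecisionTree
open scoped Classical

variable {V : Type*} [Fintype V]

/-! ### The seed: a two-edge path through `g` -/

/-- **The path `u — g — v`** (`{s(g,u)} ∪ {s(g,v)}`, weights `x, y`, `g, u, v` distinct): its four numbers are
`P(u ∈ cl g) = x`, `P(v ∈ cl g) = y`, `P(u, v ∈ cl g) = xy`, `P(u ∉ cl g, v ∈ cl u) = 0`. [folklore] -/
theorem vee_numbers (p : Sym2 V → ℝ) (g u v : V) (hgu : g ≠ u) (hgv : g ≠ v) (huv : u ≠ v) :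
    PrW ({s(g, u)} ∪ {s(g, v)}) p {K : Finset (Sym2 V) | u ∈ cl K g} = p s(g, u)
    ∧ PrW ({s(g, u)} ∪ {s(g, v)}) p {K : Finset (Sym2 V) | v ∈ cl K g} = p s(g, v)
    ∧ PrW ({s(g, u)} ∪ {s(g, v)}) p {K : Finset (Sym2 V) | u ∈ cl K g ∧ v ∈ cl K g} = p s(g, u) * p s(g, v)
    ∧ PrW ({s(g, u)} ∪ {s(g, v)}) p {K : Finset (Sym2 V) | u ∉ cl K g ∧ v ∈ cl K u} = 0 := by
  have hdisj : Disjoint ({s(g, u)} : Finset (Sym2 V)) {s(g, v)} := by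
    rw [Finset.disjoint_singleton_left, Finset.mem_singleton, Sym2.eq_iff]
    rintro (⟨-, h⟩ | ⟨h, -⟩)
    · exact huv h
    · exact hgv h
  have hsep : ∀ x : V, (∃ e ∈ ({s(g, u)} : Finset (Sym2 V)), x ∈ e) → (∃ e ∈ ({s(g, v)} : Finset (Sym2 V)), x ∈ e) →
      (x = g ∨ x = u ∨ x = v) := by
    rintro x ⟨e, he, hxe⟩ _
    rw [Finset.mem_singleton] at he
    subst he
    rcases Sym2.mem_iff.1 hxe with rfl | rfl
    · exact Or.inl rfl
    · exact Or.inr (Or.inl rfl)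
  have b0 := bEdge_cell_zero p g u v hgu hgv huv
  have bB := bEdge_cell_ab p g u v hgu hgv huv
  have bA := bEdge_cell_ac p g u v hgu hgv huv
  have bM := bEdge_cell_bc p g u v hgu hgv huv
  have bT := bEdge_cell_three p g u v hgu hgv huv
  have c0 := cEdge_cell_zero p g u v hgu hgv huv
  have cB := cEdge_cell_ab p g u v hgu hgv huv
  have cA := cEdge_cell_ac p g u v hgu hgv huv
  have cM := cEdge_cell_bc p g u v hgu hgv huv
  have cT := cEdge_cell_three p g u v hgu hgv huv
  rw [conn_eq_cells_b p _ g u v, conn_eq_cells_c p _ g u v, m_event_eq_cell p _ g u v,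
    glued_cell_ab p _ _ hdisj g u v hsep, glued_cell_ac p _ _ hdisj g u v hsep, glued_cell_bc p _ _ hdisj g u v hsep,
    glued_cell_three p _ _ hdisj g u v hsep, b0, bB, bA, bM, bT, c0, cB, cA, cM, cT]
  refine ⟨by ring, by ring, by ring, by ring⟩

/-! ### Bookkeeping of the ladder -/

section Ladder

variable (z : ℕ → V) (L : ℕ → Finset (Sym2 V))
  (hL0 : L 0 = {s(z 0, z 1)} ∪ {s(z 0, z 2)})
  (hLs : ∀ r : ℕ, L (r + 1) = ({s(z (2 * r + 3), z (2 * r + 1))} ∪ (L r ∪ {s(z (2 * r + 1), z (2 * r + 2))})) ∪ {s(z (2 * r + 4), z (2 * r + 2))})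

include hL0 hLs

omit [Fintype V] in
/-- The edges of `L n`: the two seed edges, and for each round `r < n` its rung and its two rails. [folklore] -/
theorem ladder_edges (n : ℕ) {e : Sym2 V} (he : e ∈ L n) :
    e = s(z 0, z 1) ∨ e = s(z 0, z 2) ∨ ∃ r, r < n ∧ (e = s(z (2 * r + 1), z (2 * r + 2)) ∨ e = s(z (2 * r + 3), z (2 * r + 1))
      ∨ e = s(z (2 * r + 4), z (2 * r + 2))) := by
  induction n with
  | zero =>
    rw [hL0, Finset.mem_union, Finset.mem_singleton, Finset.mem_singleton] at he
    rcases he with h | h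
    · exact Or.inl h
    · exact Or.inr (Or.inl h)
  | succ n ih =>
    rw [hLs n, Finset.mem_union, Finset.mem_union, Finset.mem_union, Finset.mem_singleton, Finset.mem_singleton,
      Finset.mem_singleton] at he
    rcases he with (h | h | h) | h
    · exact Or.inr (Or.inr ⟨n, Nat.lt_succ_self n, Or.inr (Or.inl h)⟩)
    · rcases ih h with h' | h' | ⟨r, hr, h'⟩
      · exact Or.inl h'
      · exact Or.inr (Or.inl h')
      · exact Or.inr (Or.inr ⟨r, Nat.lt_succ_of_lt hr, h'⟩)
    · exact Or.inr (Or.inr ⟨n, Nat.lt_succ_self n, Or.inl h⟩)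
    · exact Or.inr (Or.inr ⟨n, Nat.lt_succ_self n, Or.inr (Or.inr h)⟩)

omit [Fintype V] in
/-- Every vertex of `L n` is some `z j` with `j ≤ 2n+2`. [folklore] -/
theorem ladder_vertex (n : ℕ) {e : Sym2 V} (he : e ∈ L n) {x : V} (hx : x ∈ e) : ∃ j, j ≤ 2 * n + 2 ∧ x = z j := by
  rcases ladder_edges z L hL0 hLs n he with rfl | rfl | ⟨r, hr, rfl | rfl | rfl⟩ <;>
    rcases Sym2.mem_iff.1 hx with rfl | rfl
  · exact ⟨0, by omega, rfl⟩
  · exact ⟨1, by omega, rfl⟩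
  · exact ⟨0, by omega, rfl⟩
  · exact ⟨2, by omega, rfl⟩
  · exact ⟨2 * r + 1, by omega, rfl⟩
  · exact ⟨2 * r + 2, by omega, rfl⟩
  · exact ⟨2 * r + 3, by omega, rfl⟩
  · exact ⟨2 * r + 1, by omega, rfl⟩
  · exact ⟨2 * r + 4, by omega, rfl⟩
  · exact ⟨2 * r + 2, by omega, rfl⟩

omit [Fintype V] in
/-- A vertex `z k` with `k > 2n+2` is off `L n` (given injectivity of `z` up to `k`). [folklore] -/
theorem ladder_new_fresh (n k : ℕ) (hk : 2 * n + 2 < k) (hz : ∀ i j, i ≤ k → j ≤ k → z i = z j → i = j) :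
    ∀ e ∈ L n, z k ∉ e := fun e he hmem => by
  obtain ⟨j, hj, hzj⟩ := ladder_vertex z L hL0 hLs n he hmem
  have := hz k j le_rfl (by omega) hzj
  omega

omit [Fintype V] in
/-- The rung of round `n` is not yet an edge of `L n`. [folklore] -/
theorem ladder_rung_fresh (n : ℕ) (hz : ∀ i j, i ≤ 2 * n + 2 → j ≤ 2 * n + 2 → z i = z j → i = j) :
    s(z (2 * n + 1), z (2 * n + 2)) ∉ L n := fun he => by
  rcases ladder_edges z L hL0 hLs n he with h | h | ⟨r, hr, h | h | h⟩ <;>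
    rcases Sym2.eq_iff.1 h with ⟨h1, h2⟩ | ⟨h1, h2⟩ <;>
    · have := hz _ _ (by omega) (by omega) h1
      have := hz _ _ (by omega) (by omega) h2
      omega

/-! ### The four numbers of the balanced ladder -/

/-- **The numbers of the balanced ladder.**  With `g = z 0`, ports `u = z(2n+1)`, `v = z(2n+2)`, seed weights `2/3`, rung weight `w`, rail
weight `c = (3+w)/(3(1+w))` (rounds `r < n`), `λ = c²(1+w)` and `F(s) = c²(s + w(1−s))`:
`P(u ∈ cl g) = P(v ∈ cl g) = (2/3)λⁿ`, `P(u, v ∈ cl g) = (4/9)λⁿ`, `P(u ∉ cl g, v ∈ cl u) = F^[n](4/9) − (4/9)λⁿ` on `L n`. [this work] -/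
theorem ladder_numbers (p : Sym2 V → ℝ) (w c : ℝ) (hc : c = (3 + w) / (3 * (1 + w))) (hw : 0 ≤ w)
    (h01 : p s(z 0, z 1) = 2 / 3) (h02 : p s(z 0, z 2) = 2 / 3) (n : ℕ)
    (hrung : ∀ r, r < n → p s(z (2 * r + 1), z (2 * r + 2)) = w)
    (hrail : ∀ r, r < n → p s(z (2 * r + 3), z (2 * r + 1)) = c ∧ p s(z (2 * r + 4), z (2 * r + 2)) = c)
    (hz : ∀ i j, i ≤ 2 * n + 2 → j ≤ 2 * n + 2 → z i = z j → i = j) :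
    PrW (L n) p {K : Finset (Sym2 V) | z (2 * n + 1) ∈ cl K (z 0)} = 2 / 3 * (c ^ 2 * (1 + w)) ^ n
    ∧ PrW (L n) p {K : Finset (Sym2 V) | z (2 * n + 2) ∈ cl K (z 0)} = 2 / 3 * (c ^ 2 * (1 + w)) ^ n
    ∧ PrW (L n) p {K : Finset (Sym2 V) | z (2 * n + 1) ∈ cl K (z 0) ∧ z (2 * n + 2) ∈ cl K (z 0)} = 4 / 9 * (c ^ 2 * (1 + w)) ^ n
    ∧ PrW (L n) p {K : Finset (Sym2 V) | z (2 * n + 1) ∉ cl K (z 0) ∧ z (2 * n + 2) ∈ cl K (z (2 * n + 1))}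
        = (fun s : ℝ => c ^ 2 * (s + w * (1 - s)))^[n] (4 / 9) - 4 / 9 * (c ^ 2 * (1 + w)) ^ n := by
  induction n with
  | zero =>
    have h01' : z 0 ≠ z 1 := fun h => by have := hz 0 1 (by omega) (by omega) h; omega
    have h02' : z 0 ≠ z 2 := fun h => by have := hz 0 2 (by omega) (by omega) h; omega
    have h12 : z 1 ≠ z 2 := fun h => by have := hz 1 2 (by omega) (by omega) h; omega
    obtain ⟨e1, e2, e3, e4⟩ := vee_numbers p (z 0) (z 1) (z 2) h01' h02' h12
    simp only [Nat.mul_zero, Nat.zero_add, hL0, Function.iterate_zero, id_eq, pow_zero, mul_one]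
    rw [e1, e2, e3, e4, h01, h02]
    norm_num
  | succ n ih =>
    obtain ⟨ip, iπ, iτ, im⟩ := ih (fun r hr => hrung r (by omega)) (fun r hr => hrail r (by omega))
      fun i j hi hj h => hz i j (by omega) (by omega) h
    -- names
    have hg1 : z (2 * n + 1) ≠ z 0 := fun h => by have := hz _ _ (by omega) (by omega) h; omega
    have hg2 : z (2 * n + 2) ≠ z 0 := fun h => by have := hz _ _ (by omega) (by omega) h; omega
    have h12 : z (2 * n + 1) ≠ z (2 * n + 2) := fun h => by have := hz _ _ (by omega) (by omega) h; omega
    have hg3 : z (2 * n + 3) ≠ z 0 := fun h => by have := hz _ _ (by omega) (by omega) h; omega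
    have h31 : z (2 * n + 3) ≠ z (2 * n + 1) := fun h => by have := hz _ _ (by omega) (by omega) h; omega
    have h32 : z (2 * n + 3) ≠ z (2 * n + 2) := fun h => by have := hz _ _ (by omega) (by omega) h; omega
    have hg4 : z (2 * n + 4) ≠ z 0 := fun h => by have := hz _ _ (by omega) (by omega) h; omega
    have h42 : z (2 * n + 4) ≠ z (2 * n + 2) := fun h => by have := hz _ _ (by omega) (by omega) h; omega
    have h43 : z (2 * n + 4) ≠ z (2 * n + 3) := fun h => by have := hz _ _ (by omega) (by omega) h; omega
    -- round n, move 1: the rung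
    have hfresh := ladder_rung_fresh z L hL0 hLs n fun i j hi hj h => hz i j (by omega) (by omega) h
    obtain ⟨rp, rπ, rτ, rm⟩ := rung p (L n) (z 0) (z (2 * n + 1)) (z (2 * n + 2)) hfresh hg1 hg2 h12
    simp only [ip, iπ, iτ, im, hrung n (Nat.lt_succ_self n)] at rp rπ rτ rm
    -- move 2: the rail at u
    have hnew3 : ∀ e ∈ L n ∪ {s(z (2 * n + 1), z (2 * n + 2))}, z (2 * n + 3) ∉ e := by
      intro e he
      rw [Finset.mem_union, Finset.mem_singleton] at he
      rcases he with he | rfl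
      · exact ladder_new_fresh z L hL0 hLs n (2 * n + 3) (by omega) (fun i j hi hj h => hz i j (by omega) (by omega) h) e he
      · intro h
        rcases Sym2.mem_iff.1 h with h | h
        · exact h31 h
        · exact h32 h
    obtain ⟨up, uπ, uτ, um⟩ := rail_u p (L n ∪ {s(z (2 * n + 1), z (2 * n + 2))}) (z 0) (z (2 * n + 1)) (z (2 * n + 2)) (z (2 * n + 3))
      hnew3 hg3 h31 h32 hg1 hg2 h12
    simp only [rp, rπ, rτ, rm, (hrail n (Nat.lt_succ_self n)).1] at up uπ uτ um
    -- move 3: the rail at v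
    have hnew4 : ∀ e ∈ {s(z (2 * n + 3), z (2 * n + 1))} ∪ (L n ∪ {s(z (2 * n + 1), z (2 * n + 2))}), z (2 * n + 4) ∉ e := by
      intro e he
      rw [Finset.mem_union, Finset.mem_singleton, Finset.mem_union, Finset.mem_singleton] at he
      rcases he with rfl | he | rfl
      · intro h
        rcases Sym2.mem_iff.1 h with h | h
        · exact h43 h
        · have := hz _ _ (by omega) (by omega) h; omega
      · exact ladder_new_fresh z L hL0 hLs n (2 * n + 4) (by omega) hz e he
      · intro h
        rcases Sym2.mem_iff.1 h with h | h
        · have := hz _ _ (by omega) (by omega) h; omega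
        · exact h42 h
    obtain ⟨vp, vπ, vτ, vm⟩ := rail_v p ({s(z (2 * n + 3), z (2 * n + 1))} ∪ (L n ∪ {s(z (2 * n + 1), z (2 * n + 2))})) (z 0)
      (z (2 * n + 3)) (z (2 * n + 2)) (z (2 * n + 4)) hnew4 hg4 h42 h43 hg3 hg2 h32
    simp only [up, uπ, uτ, um, (hrail n (Nat.lt_succ_self n)).2] at vp vπ vτ vm
    have e3 : 2 * (n + 1) + 1 = 2 * n + 3 := by ring
    have e4 : 2 * (n + 1) + 2 = 2 * n + 4 := by ring
    rw [e3, e4, hLs n, vp, vπ, vτ, vm, Function.iterate_succ_apply', pow_succ]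
    have h3 : (3 : ℝ) * (1 + w) ≠ 0 := by positivity
    have key : c * (3 * (1 + w)) = 3 + w := by rw [hc]; field_simp
    refine ⟨?_, ?_, ?_, ?_⟩
    · linear_combination (-(2 / 9) * c * (c ^ 2 * (1 + w)) ^ n) * key
    · linear_combination (-(2 / 9) * c * (c ^ 2 * (1 + w)) ^ n) * key
    · ring
    · ring

end Ladder

end APL

end Summit.CriticalPhenomena.PercolationContinuityZ3.Theorems
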